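import Summits.QuantumFields.YangMills.Theorems.UnitScaleTiltProp7FibreVelocityOneStep
import Summits.QuantumFields.YangMills.Theorems.UnitScaleTiltProp8IterTangent
import HarnessLib

/-!
# Route `UnitScaleTilt`, crux K1 child «MinimiserStabilityRegPr» (stmt-QuantumFields-19200) — «blend-ℓ²» line (OWNER RULING g24-№1 §B), stub S4
# `firstVariationFibre`, step (iii) ALL LEVELS: **THE `k`-FOLD CORRECTOR VELOCITY ON THE TREE IS AT MOST `∏_{i<k}(L^{1−d} − 148·stokesConst·t_i)⁻¹ ×`
# THE DEFECT VELOCITY OF THE `k`-FOLD AVERAGE** — a-posteriori, for ANY lift through the minimal tower, with a LEVEL-DEPENDENT smallness profile `t_i`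

Cell `ym3-torus` ∕ width seat `ym-ust-19200-w1` (gen 0; HUMAN RULING D-0037 — YM₃ on T³ is ladder rung R3, not the Clay problem).

WHY.  p2's `k`-fold corrected lift (`Prop8Criticality.exists_iter_lift_curve`) of an ambient family `Γ₀` into the (0.4)-descent fibre changes `Γ₀` only on
the bottom `T₀` of a tower of bond sets; with the MINIMAL tower (`T_i = β(T_{i+1})` below the top) the lifted family `γ` and `Γ₀` have iterated averages
agreeing off `T_i` at every level (`eventually_iter_eq_off_tower`), so the one-level a-posteriori bound of the previous file
(`Prop7FibreVelocity.norm_deriv_centralBond_sub_le`) telescopes down the levels: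
`Σ_b ‖γ̇_b − Γ̇₀,b‖ ≤ ∏_{i<n}(L^{1−d} − 148·stokesConst·t_i)⁻¹ · Σ_c ‖(d/ds)[γ̄^{(n)}(s)(c) − Γ̄₀^{(n)}(s)(c)]|₀‖` (`sum_norm_deriv_sub_le_prod`).
The point of the level-dependent profile `t_i` (`PlaqSmall (t i)` of the `i`-th iterated average of the base field): for print's regular fields it is
GEOMETRIC, `t_i = (10800L+1)·L^{2i}·ε₀L^{−2(K−n)}` (`IterPlaqSmallAllL.plaqSmall_iter_T3_allL`), so the product is `≤ 2·L^{(d−1)n}` UNIFORMLY IN `n` once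
`ε₀ ≤ c·L^{−5}` — the `k`-uniform multiplier weight of the blend-ℓ² card (CARD-19200-V3-g9 §8: `‖Λ‖_∞ ≤ C·ε₀·L^{−(K−n)}` after pairing with the current
`‖J‖_∞ < ε₀L^{−3(K−n)}`); the T³ assembly is the next file.

WHAT IS PROVED (sorry-free, no definition).  `eventually_iter_eq_off_tower` (agreement of the iterated averages off the minimal tower — pure locality of
(0.4), no smallness), **`sum_norm_deriv_sub_le_prod`** (the title bound, induction on the level peeling the top averaging).

HONEST SCOPE.  A-posteriori bounds for a given lift; existence of the lift is p2's theorem and is not re-proved.  Count-neutral helper toward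
stmt-QuantumFields-19200 (`--supports`); nothing continuum ∕ OS ∕ mass-gap ∕ Clay.

References: T. Bałaban, CMP **109** (1987) 249–301 [Balaban1987RG1] ((0.4), (0.11) p.253); CMP **102** (1985) 277–309 [Balaban1985Variational]
((47)–(48) p.287, (127) p.297, Sect. F p.300).
-/

noncomputable section

open scoped BigOperators Matrix.Norms.L2Operator Matrix Topology
open Filter Function NormedSpace

namespace Summit.QuantumFields.YangMills.Theorems.Prop7FibreVelocity

open Literature.MathematicalPhysics.QuantumFieldTheory.Balaban1983to89
open T4Continuum AveragingRT BlockAveraging BlockAveragingHaarAC BlockAveragingEMLHaarAC ExpMeanLog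
open Summit.QuantumFields.YangMills.Theorems.BlockAvgCorrector (stokesConst stokesConst_nonneg)
open Summit.QuantumFields.YangMills.Theorems.Prop8Criticality (avgFun_eq_avgFun_update_of_agree iter_succ_eq_avgFun iter_zero_apply differentiableAt_coe_iter)

variable {P : Params}

/-! ## §1 Agreement of the iterated averages off the minimal tower -/

/-- **OFF THE MINIMAL TOWER THE ITERATED AVERAGES OF THE LIFT AND OF THE AMBIENT FAMILY AGREE** (near `s = 0`): if `T_i = β(T_{i+1})` for `i < n` and
`γ(s) = Γ₀(s)` near `0` at every bond off `T₀`, then `γ̄^{(n)}(s)(c) = Γ̄₀^{(n)}(s)(c)` near `0` for every level-`n` bond `c ∉ T_n` (locality of (0.4): the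
average at `c` sees only the non-central bonds and its own central bond `β(c)`, `avgFun_eq_avgFun_update_of_agree`). [cite: Balaban1987RG1, (0.4), (0.11) p.253] -/
theorem eventually_iter_eq_off_tower :
    ∀ n : ℕ, n ≤ P.m + P.K →
    ∀ (Γ₀ γ : ℝ → GaugeField P 0 (Matrix.specialUnitaryGroup (Fin 2) ℂ)) (T : (i : ℕ) → Set (PBond P i)),
      (∀ i, i < n → ∀ b : PBond P i, b ∈ T i ↔ ∃ c ∈ T (i + 1), centralBond c = b) →
      (∀ b : PBond P 0, b ∉ T 0 → ∀ᶠ s in 𝓝 (0 : ℝ), γ s b = Γ₀ s b) →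
      ∀ c : PBond P n, c ∉ T n → ∀ᶠ s in 𝓝 (0 : ℝ),
        Averaging.iter (fun i => blockAvg (P := P) (j := i) (expMeanLogSU (n := Fin 2))) n (γ s) c
          = Averaging.iter (fun i => blockAvg (P := P) (j := i) (expMeanLogSU (n := Fin 2))) n (Γ₀ s) c
  | 0, _, Γ₀, γ, T, _, h0, c, hc => by simpa only [iter_zero_apply] using h0 c hc
  | n + 1, hn, Γ₀, γ, T, hT, h0, c, hc => by
    classical
    have ih := eventually_iter_eq_off_tower n (Nat.le_of_succ_le hn) Γ₀ γ T (fun i hi => hT i (Nat.lt_succ_of_lt hi)) h0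
    have hnc : ∀ b : PBond P n, (∀ c' : PBond P (n + 1), centralBond c' ≠ b) → b ∉ T n := fun b hb hbT => by
      obtain ⟨c', -, hc'⟩ := (hT n (Nat.lt_succ_self n) b).mp hbT
      exact hb c' hc'
    have hβc : centralBond c ∉ T n := fun h => by
      obtain ⟨c', hc'T, hc'⟩ := (hT n (Nat.lt_succ_self n) _).mp h
      exact hc (centralBond_injective hn hc' ▸ hc'T)
    have hall : ∀ᶠ s in 𝓝 (0 : ℝ),
        (∀ b : PBond P n, (∀ c' : PBond P (n + 1), centralBond c' ≠ b) →
          Averaging.iter (fun i => blockAvg (P := P) (j := i) (expMeanLogSU (n := Fin 2))) n (γ s) b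
            = Averaging.iter (fun i => blockAvg (P := P) (j := i) (expMeanLogSU (n := Fin 2))) n (Γ₀ s) b) ∧
        Averaging.iter (fun i => blockAvg (P := P) (j := i) (expMeanLogSU (n := Fin 2))) n (γ s) (centralBond c)
          = Averaging.iter (fun i => blockAvg (P := P) (j := i) (expMeanLogSU (n := Fin 2))) n (Γ₀ s) (centralBond c) := by
      refine (Filter.eventually_all.mpr fun b => ?_).and (ih _ hβc)
      by_cases hb : ∀ c' : PBond P (n + 1), centralBond c' ≠ b
      · exact (ih b (hnc b hb)).mono fun s hs _ => hs
      · exact Filter.Eventually.of_forall fun s h => absurd h hb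
    filter_upwards [hall] with s hs
    rw [iter_succ_eq_avgFun, iter_succ_eq_avgFun, avgFun_eq_avgFun_update_of_agree hn _ _ _ c hs.1, hs.2, update_eq_self]

/-! ## §2 The `k`-fold a-posteriori velocity bound -/

/-- **THE `k`-FOLD CORRECTOR VELOCITY ON THE TREE.**  Let `t_i ≤ t₀` (`i < n`) be a smallness profile with `stokesConst·t₀ ≤ 1/24` and `148·stokesConst·t_i < L^{1−d}` (`i < n`).
For every level `n ≤ m + K`, every two bondwise differentiable families `Γ₀`, `γ` of finest `SU(2)` fields with `γ(0) = Γ₀(0)`, whose base field has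
`t_i`-small `i`-fold averages (`i < n`), every MINIMAL tower `T` below `n` (`T_i = β(T_{i+1})`, `i < n`) with `γ = Γ₀` near `0` off `T₀`:
`Σ_b ‖γ̇_b(0) − Γ̇₀,b(0)‖ ≤ ∏_{i<n}(L^{1−d} − 148·stokesConst·t_i)⁻¹ · Σ_c ‖(d/ds)γ̄^{(n)}(s)(c)|₀ − (d/ds)Γ̄₀^{(n)}(s)(c)|₀‖`
(all velocities in matrices).  Induction peeling the top averaging: the one-level bound `norm_deriv_centralBond_sub_le` at level `n` for the pair
(`Γ̄₀^{(n)}`, `γ̄^{(n)}`), which agree off the central bonds by `eventually_iter_eq_off_tower`, then the induction hypothesis.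
[cite: Balaban1987RG1, (0.4), (0.11) p.253; Balaban1985Variational, (47)–(48) p.287, (127) p.297] -/
theorem sum_norm_deriv_sub_le_prod {t : ℕ → ℝ} {t₀ : ℝ} (ht₀ : 0 < t₀) (hv24 : stokesConst P * t₀ ≤ 1 / 24) (ht0 : ∀ i, 0 < t i) :
    ∀ n : ℕ, n ≤ P.m + P.K → (∀ i, i < n → t i ≤ t₀) → (∀ i, i < n → 148 * (stokesConst P * t i) < (((P.L : ℝ) ^ (P.d - 1)))⁻¹) →
    ∀ Γ₀ γ : ℝ → GaugeField P 0 (Matrix.specialUnitaryGroup (Fin 2) ℂ),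
      (∀ b : PBond P 0, DifferentiableAt ℝ (fun s : ℝ => (Γ₀ s b : Matrix (Fin 2) (Fin 2) ℂ)) 0) →
      (∀ b : PBond P 0, DifferentiableAt ℝ (fun s : ℝ => (γ s b : Matrix (Fin 2) (Fin 2) ℂ)) 0) →
      γ 0 = Γ₀ 0 →
      (∀ i, i < n → PlaqSmall (t i) (Averaging.iter (fun i => blockAvg (P := P) (j := i) (expMeanLogSU (n := Fin 2))) i (Γ₀ 0))) →
    ∀ T : (i : ℕ) → Set (PBond P i),
      (∀ i, i < n → ∀ b : PBond P i, b ∈ T i ↔ ∃ c ∈ T (i + 1), centralBond c = b) →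
      (∀ b : PBond P 0, b ∉ T 0 → ∀ᶠ s in 𝓝 (0 : ℝ), γ s b = Γ₀ s b) →
    ∑ b : PBond P 0, ‖deriv (fun s : ℝ => ((γ s b : Matrix.specialUnitaryGroup (Fin 2) ℂ) : Matrix (Fin 2) (Fin 2) ℂ)) 0
        - deriv (fun s : ℝ => ((Γ₀ s b : Matrix.specialUnitaryGroup (Fin 2) ℂ) : Matrix (Fin 2) (Fin 2) ℂ)) 0‖
      ≤ (∏ i ∈ Finset.range n, ((((P.L : ℝ) ^ (P.d - 1)))⁻¹ - 148 * (stokesConst P * t i))⁻¹)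
        * ∑ c : PBond P n, ‖deriv (fun s : ℝ => ((Averaging.iter (fun i => blockAvg (P := P) (j := i) (expMeanLogSU (n := Fin 2))) n (γ s) c :
              Matrix.specialUnitaryGroup (Fin 2) ℂ) : Matrix (Fin 2) (Fin 2) ℂ)) 0
            - deriv (fun s : ℝ => ((Averaging.iter (fun i => blockAvg (P := P) (j := i) (expMeanLogSU (n := Fin 2))) n (Γ₀ s) c :
              Matrix.specialUnitaryGroup (Fin 2) ℂ) : Matrix (Fin 2) (Fin 2) ℂ)) 0‖ := by
  intro n
  induction n with
  | zero =>
    intro _ _ _ Γ₀ γ _ _ _ _ T _ _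
    simp only [Finset.range_zero, Finset.prod_empty, one_mul, iter_zero_apply]
    exact le_rfl
  | succ n ih =>
    intro hn htle hρ Γ₀ γ hΓ hγ h0 hsm T hT hag
    classical
    have hst : 0 ≤ stokesConst P := stokesConst_nonneg P
    have h2t₀ : stokesConst P * (2 * t₀) < 1 / 3 := by nlinarith
    have hsm₀ : ∀ i, i < n + 1 → PlaqSmall t₀ (Averaging.iter (fun i => blockAvg (P := P) (j := i) (expMeanLogSU (n := Fin 2))) i (Γ₀ 0)) :=
      fun i hi p => (hsm i hi p).trans_le (htle i hi)
    have hsmγ : ∀ i, i < n + 1 → PlaqSmall t₀ (Averaging.iter (fun i => blockAvg (P := P) (j := i) (expMeanLogSU (n := Fin 2))) i (γ 0)) := by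
      rw [h0]; exact hsm₀
    -- the induction hypothesis for the same pair and tower, one level down
    have hIH := ih (Nat.le_of_succ_le hn) (fun i hi => htle i (Nat.lt_succ_of_lt hi)) (fun i hi => hρ i (Nat.lt_succ_of_lt hi))
      Γ₀ γ hΓ hγ h0 (fun i hi => hsm i (Nat.lt_succ_of_lt hi)) T (fun i hi => hT i (Nat.lt_succ_of_lt hi)) hag
    -- the level-`n` families `Λ = Γ̄₀^{(n)}`, `μ = γ̄^{(n)}`
    set Λ : ℝ → GaugeField P n (Matrix.specialUnitaryGroup (Fin 2) ℂ) :=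
      fun s => Averaging.iter (fun i => blockAvg (P := P) (j := i) (expMeanLogSU (n := Fin 2))) n (Γ₀ s) with hΛ
    set μ : ℝ → GaugeField P n (Matrix.specialUnitaryGroup (Fin 2) ℂ) :=
      fun s => Averaging.iter (fun i => blockAvg (P := P) (j := i) (expMeanLogSU (n := Fin 2))) n (γ s) with hμ
    have hΛdiff : ∀ b : PBond P n, DifferentiableAt ℝ (fun s : ℝ => ((Λ s b : Matrix.specialUnitaryGroup (Fin 2) ℂ) : Matrix (Fin 2) (Fin 2) ℂ)) 0 :=
      differentiableAt_coe_iter ht₀ h2t₀ Γ₀ hΓ n (fun i hi => hsm₀ i (Nat.lt_succ_of_lt hi))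
    have hμdiff : ∀ b : PBond P n, DifferentiableAt ℝ (fun s : ℝ => ((μ s b : Matrix.specialUnitaryGroup (Fin 2) ℂ) : Matrix (Fin 2) (Fin 2) ℂ)) 0 :=
      differentiableAt_coe_iter ht₀ h2t₀ γ hγ n (fun i hi => hsmγ i (Nat.lt_succ_of_lt hi))
    have hΛdiff' : ∀ c : PBond P (n + 1), DifferentiableAt ℝ (fun s : ℝ =>
        ((avgFun (expMeanLogSU (n := Fin 2)) (Λ s) c : Matrix.specialUnitaryGroup (Fin 2) ℂ) : Matrix (Fin 2) (Fin 2) ℂ)) 0 := by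
      intro c
      have h1 := differentiableAt_coe_iter ht₀ h2t₀ Γ₀ hΓ (n + 1) hsm₀ c
      simp only [iter_succ_eq_avgFun] at h1
      exact h1
    have hμdiff' : ∀ c : PBond P (n + 1), DifferentiableAt ℝ (fun s : ℝ =>
        ((avgFun (expMeanLogSU (n := Fin 2)) (μ s) c : Matrix.specialUnitaryGroup (Fin 2) ℂ) : Matrix (Fin 2) (Fin 2) ℂ)) 0 := by
      intro c
      have h1 := differentiableAt_coe_iter ht₀ h2t₀ γ hγ (n + 1) hsmγ c
      simp only [iter_succ_eq_avgFun] at h1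
      exact h1
    have hμ0 : μ 0 = Λ 0 := by simp only [hμ, hΛ, h0]
    have hΛsmall : PlaqSmall (t n) (Λ 0) := hsm n (Nat.lt_succ_self n)
    -- agreement of `μ`, `Λ` off the central bonds (the tower is minimal at level `n`)
    have hoff := eventually_iter_eq_off_tower n (Nat.le_of_succ_le hn) Γ₀ γ T (fun i hi => hT i (Nat.lt_succ_of_lt hi)) hag
    have hnc : ∀ b : PBond P n, (∀ c' : PBond P (n + 1), centralBond c' ≠ b) → b ∉ T n := fun b hb hbT => by
      obtain ⟨c', -, hc'⟩ := (hT n (Nat.lt_succ_self n) b).mp hbT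
      exact hb c' hc'
    have hagree : ∀ᶠ s in 𝓝 (0 : ℝ), ∀ b : PBond P n, (∀ c' : PBond P (n + 1), centralBond c' ≠ b) → μ s b = Λ s b := by
      refine Filter.eventually_all.mpr fun b => ?_
      by_cases hb : ∀ c' : PBond P (n + 1), centralBond c' ≠ b
      · exact (hoff b (hnc b hb)).mono fun s hs _ => hs
      · exact Filter.Eventually.of_forall fun s h => absurd h hb
    -- the one-level bound at level `n`, at every coarse bond
    have hv24n : stokesConst P * t n ≤ 1 / 24 := (mul_le_mul_of_nonneg_left (htle n (Nat.lt_succ_self n)) hst).trans hv24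
    have hstep : ∀ c : PBond P (n + 1),
        ‖deriv (fun s : ℝ => ((μ s (centralBond c) : Matrix.specialUnitaryGroup (Fin 2) ℂ) : Matrix (Fin 2) (Fin 2) ℂ)) 0
            - deriv (fun s : ℝ => ((Λ s (centralBond c) : Matrix.specialUnitaryGroup (Fin 2) ℂ) : Matrix (Fin 2) (Fin 2) ℂ)) 0‖
          ≤ ((((P.L : ℝ) ^ (P.d - 1)))⁻¹ - 148 * (stokesConst P * t n))⁻¹ *
            ‖deriv (fun s : ℝ => ((avgFun (expMeanLogSU (n := Fin 2)) (μ s) c : Matrix.specialUnitaryGroup (Fin 2) ℂ) : Matrix (Fin 2) (Fin 2) ℂ)) 0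
              - deriv (fun s : ℝ => ((avgFun (expMeanLogSU (n := Fin 2)) (Λ s) c : Matrix.specialUnitaryGroup (Fin 2) ℂ) : Matrix (Fin 2) (Fin 2) ℂ)) 0‖ :=
      fun c => norm_deriv_centralBond_sub_le hn (ht0 n) hv24n (hρ n (Nat.lt_succ_self n)) Λ μ hΛdiff hμdiff hΛsmall hμ0 hagree c
        (hμdiff' c).hasDerivAt (hΛdiff' c).hasDerivAt
    -- summing over the level-`n` bonds: only central bonds contribute
    set f : PBond P n → ℝ := fun b =>
      ‖deriv (fun s : ℝ => ((μ s b : Matrix.specialUnitaryGroup (Fin 2) ℂ) : Matrix (Fin 2) (Fin 2) ℂ)) 0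
        - deriv (fun s : ℝ => ((Λ s b : Matrix.specialUnitaryGroup (Fin 2) ℂ) : Matrix (Fin 2) (Fin 2) ℂ)) 0‖ with hf
    have hvan : ∀ b ∈ (Finset.univ : Finset (PBond P n)), b ∉ Finset.univ.image (centralBond : PBond P (n + 1) → PBond P n) → f b = 0 := by
      intro b _ hb
      have hb' : ∀ c' : PBond P (n + 1), centralBond c' ≠ b := fun c' h => hb (Finset.mem_image.mpr ⟨c', Finset.mem_univ _, h⟩)
      have heq : (fun s : ℝ => ((μ s b : Matrix.specialUnitaryGroup (Fin 2) ℂ) : Matrix (Fin 2) (Fin 2) ℂ))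
          =ᶠ[𝓝 0] (fun s : ℝ => ((Λ s b : Matrix.specialUnitaryGroup (Fin 2) ℂ) : Matrix (Fin 2) (Fin 2) ℂ)) :=
        (hoff b (hnc b hb')).mono fun s hs => by
          show ((μ s b : Matrix.specialUnitaryGroup (Fin 2) ℂ) : Matrix (Fin 2) (Fin 2) ℂ) = ((Λ s b : Matrix.specialUnitaryGroup (Fin 2) ℂ) : Matrix (Fin 2) (Fin 2) ℂ)
          simp only [hμ, hΛ, hs]
      rw [hf]
      show ‖_ - _‖ = 0
      rw [heq.deriv_eq, sub_self, norm_zero]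
    have hsumn : ∑ b : PBond P n, f b ≤ ((((P.L : ℝ) ^ (P.d - 1)))⁻¹ - 148 * (stokesConst P * t n))⁻¹ *
        ∑ c : PBond P (n + 1), ‖deriv (fun s : ℝ => ((avgFun (expMeanLogSU (n := Fin 2)) (μ s) c : Matrix.specialUnitaryGroup (Fin 2) ℂ) : Matrix (Fin 2) (Fin 2) ℂ)) 0
              - deriv (fun s : ℝ => ((avgFun (expMeanLogSU (n := Fin 2)) (Λ s) c : Matrix.specialUnitaryGroup (Fin 2) ℂ) : Matrix (Fin 2) (Fin 2) ℂ)) 0‖ := by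
      calc ∑ b : PBond P n, f b = ∑ b ∈ Finset.univ.image (centralBond : PBond P (n + 1) → PBond P n), f b :=
            (Finset.sum_subset (Finset.subset_univ _) hvan).symm
        _ = ∑ c : PBond P (n + 1), f (centralBond c) :=
            Finset.sum_image fun c _ c' _ h => centralBond_injective hn h
        _ ≤ ∑ c : PBond P (n + 1), ((((P.L : ℝ) ^ (P.d - 1)))⁻¹ - 148 * (stokesConst P * t n))⁻¹ *
            ‖deriv (fun s : ℝ => ((avgFun (expMeanLogSU (n := Fin 2)) (μ s) c : Matrix.specialUnitaryGroup (Fin 2) ℂ) : Matrix (Fin 2) (Fin 2) ℂ)) 0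
              - deriv (fun s : ℝ => ((avgFun (expMeanLogSU (n := Fin 2)) (Λ s) c : Matrix.specialUnitaryGroup (Fin 2) ℂ) : Matrix (Fin 2) (Fin 2) ℂ)) 0‖ :=
            Finset.sum_le_sum fun c _ => hstep c
        _ = _ := by rw [← Finset.mul_sum]
    -- assembling
    have hC0 : 0 ≤ ∏ i ∈ Finset.range n, ((((P.L : ℝ) ^ (P.d - 1)))⁻¹ - 148 * (stokesConst P * t i))⁻¹ :=
      Finset.prod_nonneg fun i hi => inv_nonneg.mpr (by linarith [hρ i (Nat.lt_succ_of_lt (Finset.mem_range.mp hi))])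
    rw [Finset.prod_range_succ]
    simp only [iter_succ_eq_avgFun]
    calc _ ≤ _ := hIH
      _ ≤ (∏ i ∈ Finset.range n, ((((P.L : ℝ) ^ (P.d - 1)))⁻¹ - 148 * (stokesConst P * t i))⁻¹) *
            (((((P.L : ℝ) ^ (P.d - 1)))⁻¹ - 148 * (stokesConst P * t n))⁻¹ *
              ∑ c : PBond P (n + 1), ‖deriv (fun s : ℝ => ((avgFun (expMeanLogSU (n := Fin 2)) (μ s) c : Matrix.specialUnitaryGroup (Fin 2) ℂ) : Matrix (Fin 2) (Fin 2) ℂ)) 0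
                - deriv (fun s : ℝ => ((avgFun (expMeanLogSU (n := Fin 2)) (Λ s) c : Matrix.specialUnitaryGroup (Fin 2) ℂ) : Matrix (Fin 2) (Fin 2) ℂ)) 0‖) :=
          mul_le_mul_of_nonneg_left hsumn hC0
      _ = _ := by rw [mul_assoc]

end Summit.QuantumFields.YangMills.Theorems.Prop7FibreVelocity

end
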